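import Literature.MathematicalPhysics.QuantumFieldTheory.Balaban1983to89.B9Eq3133H1kPiSubH1kLetterTower
import Literature.MathematicalPhysics.QuantumFieldTheory.Balaban1983to89.B9Eq3130GtildeMinusG1kGradRowsClosed

/-!
# `Balaban1983to89.B9Eq3133H1kPiSubH1kGradientLetterTower` — T. Bałaban, *Propagators for lattice gauge theories in a background field*, Commun. Math. Phys. **99** (1985) 389–434
# [Balaban1985BackgroundPropagators] (3.126) p. 420, (3.131)–(3.133) p. 422, (3.130) p. 421, (3.117) p. 419, (3.3) p. 391, Thm 3.11 p. 416, with [Balaban1985Variational] (45) p. 285,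
# (117) p. 295: **THE SLOT DIFFERENCE OF THE MINIMIZERS `H̃_k(U) − H_k(U)`, GRADIENT MEMBER — the slice derivative `D_U(·)_μ`, the covariant gradient `∇_U` and the FLAT gradient `∇_1` of
# `(H̃_k − H_k)z` as local letters with the small factor `j₀ + α`, constants BEFORE `n, η, m, U`** — `H̃ − H = (G̃ − G)Q†K̃⁻¹ + GQ†(K̃⁻¹ − K⁻¹)` with the gradient falling on the LEFT
# factors: gen 101's slot-difference gradient row `B9Eq3130GtildeMinusG1kGradRowsClosed` (factor `max(α, j₀)`, by the monotonicity of the windows) and the owner's slice-gradient row of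
# `G₁,k(U)`; the companion of the value member `B9Eq3133H1kPiSubH1kLetterTower`; with this lineage's `B9Eq3126H1kTwoBackgroundGradientLetterTower` (`H_k(U) − H_k(1)`) and
# `B9Eq3119DeltaPiTowerFlat` (`H̃_k(1) = H_k(1)`) it gives the gradient member of the π two-background ladder of `H̃_k`, i.e. the second sup row the (117) socket asks for

statement-level skeleton of published theorems with citation tags; proofs where landed; nothing here is a claim about the Yang–Mills mass gap

CITATION HEADER (lean-in-tree rule).  Audit cell `pub-balaban`, sub-cell `t4`, BINDER row NE9; filed by NE9 crux-team LEAF PROVER 01 (`b2b-balaban-t4-ne9-formalise-leaf-01`, gen 101;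
ROUTE (J′), π-side; bears_on: R4/N22).  Composition BY NAME: this lineage's gen-101 `B9Eq3130GtildeMinusG1kGradRowsClosed.exists_local_rows_G1kPi_sub_G1k` (slice row of `G̃_k − G₁,k`),
`B9Eq3132KinvPiSubKinvLetterTower.exists_letter_KinvPi_sub_Kinv`, `B9Eq3133H1kPiSubH1kLetterTower.exists_letter_H1kPi_sub_H1k` (the value letter, for the flat-gradient correction);
ne9-leaf-05's (K80) `B9Eq3132QGtildeQInvLetterClosed.exists_local_letter_KinvLatticeKPi`, `B9Eq326G1SupRowOfLetters.{letter_comp, letter_add}`; the OWNER's (E2)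
`B9Eq326G1kSliceGradRowClosed.exists_local_gradLetter_G1k` (MODEL row — O-NE9-1, #5 UNRULED) with `B9Eq326LocalPartTowerSliceGradientRow.norm_covGrad_apply_le_of_slice`; ne9-leaf-03's
`B9Eq315QkSingleBondLetter.norm_adjoint_QkW_apply_le_local_sharp`; ne9-leaf-04's `B9Eq373TransporterLipschitzLetters.norm_adTransportW_sub_adTransportW_le`; `B5Eq172HodgePositivity.adTransportW_one`.
Source READ first-hand in the held text layer `paper:balaban1985-cmp99-background-propagators` (journal page = PDF page + 388) pp. 391, 419–422.  NOTHING of print's proofs is reproduced: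
[folklore] telescoping + letter compositions + one transporter difference (the pattern of this lineage's `B9Eq3126H1kTwoBackgroundGradientLetterTower` and
`B9Eq386BondPropagatorTwoBackgroundGradientLetterTower`).

WHAT IS PROVED (sorry-free; proof lane — 0 `def`; [folklore]).
* **`exists_gradLetter_H1kPi_sub_H1k`** — `∃ α₁ j₁ > 0, K ≥ 0, κ > 0` BEFORE (K80)'s binder block VERBATIM `+ (μ : Fin d)`: for every coarse-bond field `z` supported over `bpos⁻¹(v)` with
  `‖z(c′)‖ ≤ F`, every `μ` and every fine bond `b`: the slice derivative `D_U((H̃_k − H_k)z)_μ(b)`, `(∇_U(H̃_k − H_k)z)(b, μ)` and `(∇_1(H̃_k − H_k)z)(b, μ)` are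
  `≤ (j₀ + α)·K·e^{−κ·d_m(Π(b₊), v)}·F` (`H̃_k = H1LatticeK hposπ hQ`, `H_k = H1LatticeK hpos hQ`).
HONEST SCOPE.  Composition BY NAME on the cell's MODEL rows (O-NE9-1, #5 UNRULED); constants crude; ONE background; the current window `‖J‖ ≤ j₀ ≤ j₁`, `c₀ = η^d`, the other windows,
unitarity, the tower data, `hαL`, the positivity and onto witnesses stay HYPOTHESES (the slot-difference row is called at the radius `max(α, j₀)`, inside its window because `α ≤ α₁`,
`j₀ ≤ j₁`); nothing of [B9] (3.130)–(3.133) asserted as printed; «NE9 ⇐ the named binders»; NE9 NOT PRINTED ∕ NOT PROVED; spine PROVED 0∕9; rung (B)+1 on a finite T⁴ — NOT infinite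
volume, NOT mass gap, NOT BetaPertH, NOT Clay.  HONEST DEPENDENCY: continuum YM on T⁴ ⇐ BetaPertH ∧ nine spine estimates (0/9 proved); BetaPertH ⇐ (D1) ∧ (D4) ∧ CAP+tail; G-an2-4
gates asym, D1 and NE2/3/4.  NEW file; nothing modified.  Net new unproved facts: 0.
-/

noncomputable section

open scoped InnerProductSpace ComplexConjugate BigOperators

namespace Literature.MathematicalPhysics.QuantumFieldTheory.Balaban1983to89.B9Eq3133H1kPiSubH1kGradientLetterTower

open B4Sect5Torus (TSite tdist tdist_nonneg tdist_triangle tdist_symm torusSum_le tdist_self)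
open B4Sect5Proof (latticeConst latticeConst_nonneg)
open B9SectCLatticeCarrier (Bond bpos btgt shift unshift shift_unshift)
open B9Eq311L2Pairing (WL2)
open B9Eq319QprimeTorus (blockCoord)
open B7Prop1Explicit (U1 Wcx boxVec)
open B11Eq103H1Complex (SiteL2K BondL2K G1LatticeK KinvLatticeK H1LatticeK covDerivL2K)
open B9Eq33CovDerivVector (covGrad covGrad_apply)
open B9Eq310DeltaPrime (plaqHolU)
open B9Eq310HessianOperator (adTransportW)
open B9Eq315QTorus (perCfg cornerSite)
open B9Eq315QTower (towerP UlevOf)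
open B9Eq316TowerFlatIsOneStep (towerP_eq_fineP_pow siteCast)
open B9Eq326OperatorTower (QkW laplaceAk G1k)
open B9Eq324DeltaPrimeATower (laplacePrimeAk)
open B9Eq3119DeltaPiTower (laplaceAkPi)
open B9Eq349BlockDistanceWeight (tdist_shift_le_one)
open B9Eq315QkSingleBondLetter (norm_adjoint_QkW_apply_le_local_sharp)
open B9Eq326G1SupRowOfLetters (letter_comp letter_add)
open B9Eq326G1kSliceGradRowClosed (exists_local_gradLetter_G1k)
open B9Eq326LocalPartTowerSliceGradientRow (norm_covGrad_apply_le_of_slice)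
open B9Eq373TransporterLipschitzLetters (norm_adTransportW_sub_adTransportW_le)
open B9Eq3132QGtildeQInvLetterClosed (exists_local_letter_KinvLatticeKPi)
open B9Eq3132KinvPiSubKinvLetterTower (exists_letter_KinvPi_sub_Kinv)
open B9Eq3133H1kPiSubH1kLetterTower (exists_letter_H1kPi_sub_H1k)
open B9Eq3130GtildeMinusG1kGradRowsClosed (exists_local_rows_G1kPi_sub_G1k)

variable {d : ℕ} (hd : 1 ≤ d) (L : ℕ) [NeZero L] (hL : 1 ≤ L) (hL3 : 3 ≤ L)
  {𝔸 : Type*} [NormedRing 𝔸] [NormedAlgebra ℂ 𝔸] [CompleteSpace 𝔸] [NormOneClass 𝔸] [StarRing 𝔸] [NormedStarGroup 𝔸] [StarModule ℂ 𝔸]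
  {W : Type*} [NormedAddCommGroup W] [InnerProductSpace ℂ W] [FiniteDimensional ℂ W] (φ : W ≃ₗ[ℂ] 𝔸)
  {Mφ Mφ' : ℝ} (hMφ : 0 ≤ Mφ) (hMφ' : 0 ≤ Mφ') (hφ : ∀ w, ‖φ w‖ ≤ Mφ * ‖w‖) (hφ' : ∀ X, ‖φ.symm X‖ ≤ Mφ' * ‖X‖) (hstar : ∀ X : 𝔸, ‖star X‖ ≤ ‖X‖)
  {a : ℝ} (ha : 0 < a) {a' : ℝ} (ha' : 0 < a') {ϱ : ℝ} (hϱ0 : 0 ≤ ϱ) (hϱ1 : ϱ < 1)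
  (τ : 𝔸 →ₗ[ℂ] ℂ) {Cτ : ℝ} (hτ : ∀ X, ‖τ X‖ ≤ Cτ * ‖X‖) (hCτ : 0 ≤ Cτ) {Mτ : ℝ} (hτm : ∀ X Y : 𝔸, ‖τ (X * Y)‖ ≤ Mτ * ‖X‖ * ‖Y‖) (hMτ : 0 ≤ Mτ)
  {ρw : ℝ} (hρw : 0 ≤ ρw)
  (hτ₁ : ∀ X : 𝔸, τ (star X) = conj (τ X)) (hτ₂ : ∀ X Y : 𝔸, τ (X * Y) = τ (Y * X)) (hφτ : ∀ X Y : 𝔸, ⟪φ.symm X, φ.symm Y⟫_ℂ = τ (star X * Y))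
  (AQ : ℝ)

include hd hL hL3 hMφ hMφ' hφ hφ' hstar ha ha' hϱ0 hϱ1 hτ hCτ hτm hMτ hρw hτ₁ hτ₂ hφτ in
set_option maxHeartbeats 3200000 in
set_option maxRecDepth 8192 in
/-- **THE SLOT DIFFERENCE `H̃_k(U) − H_k(U)`, GRADIENT MEMBER** — see the module docstring. [folklore]
[cite: Balaban1985BackgroundPropagators, (3.126) p.420, (3.131)–(3.133) p.422, (3.130) p.421, (3.117) p.419, (3.3) p.391; Balaban1985Variational, (45) p.285, (117) p.295] -/
theorem exists_gradLetter_H1kPi_sub_H1k :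
    ∃ α₁ j₁ K κ : ℝ, 0 < α₁ ∧ 0 < j₁ ∧ 0 ≤ K ∧ 0 < κ ∧
      ∀ (n : ℕ) (η : ℝ) (_hηL : η * (L : ℝ) ^ (n + 1) = 1) (c₀ c₁ : ℝ) [Fact (0 < c₀)] [Fact (0 < c₁)]
        (_hw : c₀ * ((L : ℝ) ^ (n + 1)) ^ d = c₁) (_hρ : |η| ^ d / c₀ ≤ ρw) (m : Fin d → ℕ) [∀ i, NeZero (m i)] (_hm : ∀ i, 1 ≤ m i)
        (U : Bond d (towerP L m (n + 1)) → 𝔸ˣ) (αU : ℕ → ℝ) (_hα0 : ∀ j, 0 ≤ αU j) (hα1 : ∀ j, αU j ≤ 1 / 64)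
        (hαL : ∀ j, 50 * (d + 1) * αU j * (L : ℝ) ^ d ≤ 1 / 2)
        (hU1 : ∀ (j : ℕ) (x : B7Prop1Explicit.Site d) (k : Fin d), perCfg (towerP L m (j + 1)) (UlevOf L m (n + 1) U j) x k ∈ U1 𝔸)
        (hreg : ∀ (j : ℕ) (y : TSite d (towerP L m j)) (k : Fin d) (ρ' : Fin d → Fin L),
          ‖((Wcx L (perCfg (towerP L m (j + 1)) (UlevOf L m (n + 1) U j)) (cornerSite L y) k (boxVec L ρ') : 𝔸ˣ) : 𝔸) - 1‖ ≤ αU j)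
        (εU : ℕ → ℝ) (_hεU : ∀ j, 0 ≤ εU j) (_hUε : ∀ (j : ℕ) (b : Bond d (towerP L m (j + 1))), ‖(UlevOf L m (n + 1) U j b : 𝔸) - 1‖ ≤ εU j)
        (_hLb : ∀ (j : ℕ) (b : Bond d (towerP L m (j + 1))), UlevOf L m (n + 1) U j b ∈ U1 𝔸)
        (α : ℝ) (_hα : 0 ≤ α) (_hαle : α ≤ α₁)
        (hUst : ∀ b, star (U b : 𝔸) = (((U b)⁻¹ : 𝔸ˣ) : 𝔸)) (_hUb : ∀ b, U b ∈ U1 𝔸) (_hUη : ∀ b, ‖(U b : 𝔸) - 1‖ ≤ α * η)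
        (_hpl : ∀ p : B9SectCLatticeCarrier.Plaq d (towerP L m (n + 1)), ‖(plaqHolU U p : 𝔸) - 1‖ ≤ α * η ^ 2)
        (_hUgrad : ∀ (x : TSite d (towerP L m (n + 1))) (μ : Fin d), ‖(U (x, μ) : 𝔸) - U (unshift μ x, μ)‖ ≤ α * η ^ 2)
        (_hRlev : ∀ (j : ℕ) (b : Bond d (towerP L m (j + 1))) (w : W), ‖adTransportW φ (UlevOf L m (n + 1) U j) b w‖ ≤ ‖w‖)
        (_hεg : ∀ j < n + 1, εU j ≤ α * ϱ ^ j) (_hAQ : ∑ j ∈ Finset.range (n + 1), αU j ≤ AQ)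
        (hpos' : ∀ x : SiteL2K ℂ d (towerP L m (n + 1)) c₀ W, x ≠ 0 → 0 < RCLike.re ⟪x, laplacePrimeAk L m n φ η U a' (c₁ := c₁) x⟫_ℂ)
        (hpos : ∀ x : BondL2K ℂ d (towerP L m (n + 1)) c₀ W, x ≠ 0 →
          0 < RCLike.re ⟪x, laplaceAk L m n φ η U hL αU hα1 hU1 hreg τ (c₀ := c₀) (c₁ := c₁) a x⟫_ℂ)
        (_hc₀η : c₀ = η ^ d) (j₀ : ℝ) (_hJ : ∀ μ y, ‖B9Eq39Adjoint.J (fun μ => B9Eq33CovDerivVector.shiftEquiv μ) (fun μ y => U (y, μ)) η μ y‖ ≤ j₀) (_hj : j₀ ≤ j₁)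
        (hposπ : ∀ x : BondL2K ℂ d (towerP L m (n + 1)) c₀ W, x ≠ 0 →
          0 < RCLike.re ⟪x, laplaceAkPi L m n φ τ η U a' hpos' hL αU hα1 hU1 hreg (c₁ := c₁) a x⟫_ℂ)
        (hQ : Function.Surjective (QkW L m n φ U hL αU hα1 hU1 hreg (c₀ := c₀) (c₁ := c₁)))
        (v : TSite d m) (z : BondL2K ℂ d m c₁ W) (F : ℝ)
        (_hzv : ∀ c', bpos c' ≠ v → WL2.equiv ℂ (fun _ : Bond d m => c₁) W z c' = 0)
        (_hzF : ∀ c', ‖WL2.equiv ℂ (fun _ : Bond d m => c₁) W z c'‖ ≤ F) (μ : Fin d) (bd : Bond d (towerP L m (n + 1))),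
        ‖WL2.equiv ℂ (fun _ : Bond d (towerP L m (n + 1)) => c₀) W
            (covDerivL2K ℂ c₀ ((η : ℂ))⁻¹ (adTransportW φ U)
              ((WL2.equiv ℂ (fun _ : TSite d (towerP L m (n + 1)) => c₀) W).symm fun y =>
                WL2.equiv ℂ (fun _ : Bond d (towerP L m (n + 1)) => c₀) W (H1LatticeK hposπ hQ z - H1LatticeK hpos hQ z) (y, μ))) bd‖ ≤
          (j₀ + α) * K * Real.exp (-(κ * tdist m (blockCoord (L ^ (n + 1)) m (siteCast (towerP_eq_fineP_pow L m (n + 1)) (btgt bd))) v)) * F ∧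
        ‖covGrad ((η : ℂ))⁻¹ (adTransportW φ U)
            (WL2.equiv ℂ (fun _ : Bond d (towerP L m (n + 1)) => c₀) W (H1LatticeK hposπ hQ z - H1LatticeK hpos hQ z)) (bd, μ)‖ ≤
          (j₀ + α) * K * Real.exp (-(κ * tdist m (blockCoord (L ^ (n + 1)) m (siteCast (towerP_eq_fineP_pow L m (n + 1)) (btgt bd))) v)) * F ∧
        ‖covGrad ((η : ℂ))⁻¹ (adTransportW φ (fun _ : Bond d (towerP L m (n + 1)) => (1 : 𝔸ˣ)))
            (WL2.equiv ℂ (fun _ : Bond d (towerP L m (n + 1)) => c₀) W (H1LatticeK hposπ hQ z - H1LatticeK hpos hQ z)) (bd, μ)‖ ≤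
          (j₀ + α) * K * Real.exp (-(κ * tdist m (blockCoord (L ^ (n + 1)) m (siteCast (towerP_eq_fineP_pow L m (n + 1)) (btgt bd))) v)) * F := by
  classical
  -- (0) the suppliers, `∃`-first
  obtain ⟨αR, BR, δR, hαR, hBR, hδR, HR⟩ :=
    exists_local_rows_G1kPi_sub_G1k hd L hL hL3 φ hMφ hMφ' hφ hφ' hstar ha ha' hϱ0 hϱ1 τ hτ hCτ hτm hMτ hρw hτ₁ hτ₂ hφτ AQ
  obtain ⟨αP, jP, BP, δP, hαP, hjP, hBP, hδP, HP⟩ :=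
    exists_local_letter_KinvLatticeKPi hd L hL hL3 φ hMφ hMφ' hφ hφ' hstar ha ha' hϱ0 hϱ1 τ hτ hCτ hτm hMτ hρw hτ₁ hτ₂ hφτ AQ
  obtain ⟨αX, jX, KX, κX, hαX, hjX, hKX, hκX, HX⟩ :=
    exists_letter_KinvPi_sub_Kinv hd L hL hL3 φ hMφ hMφ' hφ hφ' hstar ha ha' hϱ0 hϱ1 τ hτ hCτ hτm hMτ hρw hτ₁ hτ₂ hφτ AQ
  obtain ⟨αG, BG, δG, hαG, hBG, hδG, GROW⟩ :=
    exists_local_gradLetter_G1k hd L hL hL3 φ hMφ hMφ' hφ hφ' hstar ha ha' hϱ0 hϱ1 τ hτ hCτ hτm hMτ hρw hτ₁ hτ₂ hφτ AQ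
  obtain ⟨αH, jH, KH, κH, hαH, hjH, hKH, hκH, HH⟩ :=
    exists_letter_H1kPi_sub_H1k hd L hL hL3 φ hMφ hMφ' hφ hφ' hstar ha ha' hϱ0 hϱ1 τ hτ hCτ hτm hMτ hρw hτ₁ hτ₂ hφτ AQ
  set κ₀ : ℝ := min (min δR δP) (min (min κX δG) κH) with hκ₀
  have hκ₀0 : 0 < κ₀ := lt_min (lt_min hδR hδP) (lt_min (lt_min hκX hδG) hκH)
  have hκ₀R : κ₀ ≤ δR := (min_le_left _ _).trans (min_le_left _ _)
  have hκ₀P : κ₀ ≤ δP := (min_le_left _ _).trans (min_le_right _ _)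
  have hκ₀X : κ₀ ≤ κX := (min_le_right _ _).trans ((min_le_left _ _).trans (min_le_left _ _))
  have hκ₀G : κ₀ ≤ δG := (min_le_right _ _).trans ((min_le_left _ _).trans (min_le_right _ _))
  have hκ₀H : κ₀ ≤ κH := (min_le_right _ _).trans (min_le_right _ _)
  set S : ℝ := latticeConst d (κ₀ / 2) with hS
  have hS0 : 0 ≤ S := latticeConst_nonneg d (half_pos hκ₀0).le
  set EA : ℝ := Real.exp (100 * d * (d + 1) * (L : ℝ) ^ d * AQ) with hEA
  set KSU : ℝ := Mφ' * Mφ * EA * ((2 * d : ℕ) : ℝ) * Real.exp κ₀ with hKSU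
  have hKSU0 : 0 ≤ KSU := by positivity
  set K : ℝ := BP * KSU * S * BR * S + KX * KSU * S * BG * S + 2 * Mφ * Mφ' * KH with hK
  have hK0 : 0 ≤ K := by positivity
  refine ⟨min (min (min αR αP) (min αX αG)) (min αH 1), min (min (min αR jP) jX) jH, K, κ₀ / 2,
    lt_min (lt_min (lt_min hαR hαP) (lt_min hαX hαG)) (lt_min hαH one_pos), lt_min (lt_min (lt_min hαR hjP) hjX) hjH, hK0, half_pos hκ₀0, ?_⟩
  intro n η hηL c₀ c₁ _ _ hw hρ m _ hm U αU hα0 hα1 hαL hU1 hreg εU hεU hUε hLb α hα hαle hUst hUb hUη hpl hUgrad hRlev hεg hAQ hpos' hpos hc₀η j₀ hJ hj hposπ hQ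
    v z F hzv hzF μ bd
  have hαR' : α ≤ αR := hαle.trans (((min_le_left _ _).trans (min_le_left _ _)).trans (min_le_left _ _))
  have hαP' : α ≤ αP := hαle.trans (((min_le_left _ _).trans (min_le_left _ _)).trans (min_le_right _ _))
  have hαX' : α ≤ αX := hαle.trans (((min_le_left _ _).trans (min_le_right _ _)).trans (min_le_left _ _))
  have hαG' : α ≤ αG := hαle.trans (((min_le_left _ _).trans (min_le_right _ _)).trans (min_le_right _ _))
  have hαH' : α ≤ αH := hαle.trans ((min_le_right _ _).trans (min_le_left _ _))
  have hα1' : α ≤ 1 := hαle.trans ((min_le_right _ _).trans (min_le_right _ _))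
  have hjR' : j₀ ≤ αR := hj.trans (((min_le_left _ _).trans (min_le_left _ _)).trans (min_le_left _ _))
  have hjP' : j₀ ≤ jP := hj.trans (((min_le_left _ _).trans (min_le_left _ _)).trans (min_le_right _ _))
  have hjX' : j₀ ≤ jX := hj.trans ((min_le_left _ _).trans (min_le_right _ _))
  have hjH' : j₀ ≤ jH := hj.trans (min_le_right _ _)
  have hc₀ : (0 : ℝ) < c₀ := Fact.out
  have hLd : (0 : ℝ) < ((L : ℝ) ^ (n + 1)) ^ d := by
    have : (0 : ℝ) < L := by exact_mod_cast hL
    positivity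
  have hLpos : (0 : ℝ) < (L : ℝ) ^ (n + 1) := pow_pos (by exact_mod_cast Nat.pos_of_ne_zero (NeZero.ne L)) _
  have hη : 0 < η := by
    by_contra h; push Not at h; nlinarith [mul_nonpos_of_nonpos_of_nonneg h hLpos.le]
  have hcn : ‖((η : ℂ))⁻¹‖ = η⁻¹ := by rw [norm_inv, Complex.norm_real, Real.norm_eq_abs, abs_of_pos hη]
  haveI : Nonempty (Bond d (towerP L m (n + 1))) := ⟨bd⟩
  have y₀ : TSite d (towerP L m (n + 1)) := fun _ => 0
  haveI : Nonempty (Bond d m) := ⟨(v, ⟨0, hd⟩)⟩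
  have hF : 0 ≤ F := (norm_nonneg _).trans (hzF (v, ⟨0, hd⟩))
  have hj₀ : 0 ≤ j₀ := (norm_nonneg _).trans (hJ ⟨0, hd⟩ y₀)
  -- the enlarged radius `α′ = max α j₀` for the slot-difference rows (every window member is monotone in `α`)
  set α' : ℝ := max α j₀ with hα'
  have hα'0 : 0 ≤ α' := hα.trans (le_max_left _ _)
  have hαα' : α ≤ α' := le_max_left _ _
  have hα'R : α' ≤ αR := max_le hαR' hjR'
  have hα'le : α' ≤ j₀ + α := max_le (by linarith) (by linarith)
  have hUη' : ∀ b', ‖(U b' : 𝔸) - 1‖ ≤ α' * η := fun b' => (hUη b').trans (by gcongr)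
  have hpl' : ∀ p : B9SectCLatticeCarrier.Plaq d (towerP L m (n + 1)), ‖(plaqHolU U p : 𝔸) - 1‖ ≤ α' * η ^ 2 := fun p => (hpl p).trans (by gcongr)
  have hUgrad' : ∀ (x : TSite d (towerP L m (n + 1))) (μ' : Fin d), ‖(U (x, μ') : 𝔸) - U (unshift μ' x, μ')‖ ≤ α' * η ^ 2 := fun x μ' =>
    (hUgrad x μ').trans (by gcongr)
  have hεg' : ∀ j < n + 1, εU j ≤ α' * ϱ ^ j := fun j hj' => (hεg j hj').trans (mul_le_mul_of_nonneg_right hαα' (pow_nonneg hϱ0 j))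
  have hJ' : ∀ (μ' : Fin d) (y : TSite d (towerP L m (n + 1))),
      ‖B9Eq39Adjoint.J (fun μ => B9Eq33CovDerivVector.shiftEquiv μ) (fun μ y => U (y, μ)) η μ' y‖ ≤ α' := fun μ' y => (hJ μ' y).trans (le_max_right _ _)
  -- names
  set piS : TSite d (towerP L m (n + 1)) → TSite d m := fun x => blockCoord (L ^ (n + 1)) m (siteCast (towerP_eq_fineP_pow L m (n + 1)) x) with hpiS
  set piB : Bond d (towerP L m (n + 1)) → TSite d m := fun b' => piS (bpos b') with hpiB
  set piT : Bond d (towerP L m (n + 1)) → TSite d m := fun b' => piS (btgt b') with hpiT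
  set piC : Bond d m → TSite d m := fun c' => c'.1 with hpiC
  set GU := G1k L m n φ η U hL αU hα1 hU1 hreg τ (c₀ := c₀) (c₁ := c₁) hpos with hGU
  set Gt := G1LatticeK hposπ with hGt
  set QU := QkW L m n φ U hL αU hα1 hU1 hreg (c₀ := c₀) (c₁ := c₁) with hQU'
  set KU := KinvLatticeK hpos hQ with hKU
  set Kp := KinvLatticeK hposπ hQ with hKp
  -- the CLMs
  obtain ⟨TGd, hTGd⟩ : ∃ T : BondL2K ℂ d (towerP L m (n + 1)) c₀ W →L[ℂ] BondL2K ℂ d (towerP L m (n + 1)) c₀ W, T = LinearMap.toContinuousLinearMap (Gt - GU) :=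
    ⟨_, rfl⟩
  obtain ⟨TGU, hTGU⟩ : ∃ T : BondL2K ℂ d (towerP L m (n + 1)) c₀ W →L[ℂ] BondL2K ℂ d (towerP L m (n + 1)) c₀ W, T = LinearMap.toContinuousLinearMap GU := ⟨_, rfl⟩
  obtain ⟨SU, hSU⟩ : ∃ T : BondL2K ℂ d m c₁ W →L[ℂ] BondL2K ℂ d (towerP L m (n + 1)) c₀ W, T = LinearMap.toContinuousLinearMap (LinearMap.adjoint QU) := ⟨_, rfl⟩
  obtain ⟨Kpcl, hKpcl⟩ : ∃ T : BondL2K ℂ d m c₁ W →L[ℂ] BondL2K ℂ d m c₁ W, T = LinearMap.toContinuousLinearMap Kp := ⟨_, rfl⟩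
  obtain ⟨KDcl, hKDcl⟩ : ∃ T : BondL2K ℂ d m c₁ W →L[ℂ] BondL2K ℂ d m c₁ W, T = LinearMap.toContinuousLinearMap (Kp - KU) := ⟨_, rfl⟩
  -- the slice derivative `u ↦ D_U u_μ` as a CLM
  obtain ⟨Dcl, hDcl⟩ : ∃ T : BondL2K ℂ d (towerP L m (n + 1)) c₀ W →L[ℂ] BondL2K ℂ d (towerP L m (n + 1)) c₀ W,
      ∀ (u : BondL2K ℂ d (towerP L m (n + 1)) c₀ W) (b' : Bond d (towerP L m (n + 1))),
        WL2.equiv ℂ (fun _ : Bond d (towerP L m (n + 1)) => c₀) W (T u) b' =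
          WL2.equiv ℂ (fun _ : Bond d (towerP L m (n + 1)) => c₀) W (covDerivL2K ℂ c₀ ((η : ℂ))⁻¹ (adTransportW φ U)
            ((WL2.equiv ℂ (fun _ : TSite d (towerP L m (n + 1)) => c₀) W).symm fun y =>
              WL2.equiv ℂ (fun _ : Bond d (towerP L m (n + 1)) => c₀) W u (y, μ))) b' :=
    ⟨LinearMap.toContinuousLinearMap (covDerivL2K ℂ c₀ ((η : ℂ))⁻¹ (adTransportW φ U) ∘ₗ
        (WL2.linearEquiv ℂ ℂ (fun _ : TSite d (towerP L m (n + 1)) => c₀)).symm.toLinearMap ∘ₗ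
        LinearMap.funLeft ℂ W (fun y : TSite d (towerP L m (n + 1)) => ((y, μ) : Bond d (towerP L m (n + 1)))) ∘ₗ
        (WL2.linearEquiv ℂ ℂ (fun _ : Bond d (towerP L m (n + 1)) => c₀)).toLinearMap), fun _ _ => rfl⟩
  -- (1) the letters at the common rate `κ₀`
  have hweak : ∀ {r' : ℝ} (t : ℝ), κ₀ ≤ r' → 0 ≤ t → Real.exp (-(r' * t)) ≤ Real.exp (-(κ₀ * t)) := fun t hr ht => Real.exp_le_exp.mpr (by nlinarith)
  have hcomp : ∀ {D : ℝ}, D ≤ 1 → (1 : ℝ) ≤ Real.exp κ₀ * Real.exp (-(κ₀ * D)) := fun {D} hD => by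
    rw [← Real.exp_add]; exact Real.one_le_exp (by nlinarith [mul_le_mul_of_nonneg_left hD hκ₀0.le])
  -- (L)(D_U∘(G̃_k − G₁,k); α′·BR, κ₀), output block `Π(b₊)`
  have hLDGd : ∀ (w : TSite d m) (f : BondL2K ℂ d (towerP L m (n + 1)) c₀ W) (F : ℝ), (∀ x, piB x ≠ w → WL2.equiv ℂ (fun _ : Bond d (towerP L m (n + 1)) => c₀) W f x = 0) →
      (∀ x, ‖WL2.equiv ℂ (fun _ : Bond d (towerP L m (n + 1)) => c₀) W f x‖ ≤ F) →
      ∀ b', ‖WL2.equiv ℂ (fun _ : Bond d (towerP L m (n + 1)) => c₀) W ((Dcl ∘L TGd) f) b'‖ ≤ (α' * BR) * Real.exp (-(κ₀ * tdist m (piT b') w)) * F := by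
    intro w f F hfv hfF b'
    have hF : 0 ≤ F := (norm_nonneg _).trans (hfF b')
    rw [ContinuousLinearMap.comp_apply, hDcl, hTGd, LinearMap.coe_toContinuousLinearMap']
    refine ((HR n η hηL c₀ c₁ hw hρ m hm U αU hα0 hα1 hU1 hreg εU hεU hUε hLb α' hα'0 hα'R hUst hUb hUη' hpl' hUgrad' hRlev hεg' hAQ hpos' hpos hposπ hc₀η hJ'
      w f F hfv hfF μ b' y₀).2.2.1).trans ?_
    exact mul_le_mul_of_nonneg_right (mul_le_mul_of_nonneg_left (hweak _ hκ₀R (tdist_nonneg m _ _)) (mul_nonneg hα'0 hBR)) hF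
  -- (L)(D_U∘G₁,k(U); BG, κ₀), output block `Π(b₊)`
  have hLDGU : ∀ (w : TSite d m) (f : BondL2K ℂ d (towerP L m (n + 1)) c₀ W) (F : ℝ), (∀ x, piB x ≠ w → WL2.equiv ℂ (fun _ : Bond d (towerP L m (n + 1)) => c₀) W f x = 0) →
      (∀ x, ‖WL2.equiv ℂ (fun _ : Bond d (towerP L m (n + 1)) => c₀) W f x‖ ≤ F) →
      ∀ b', ‖WL2.equiv ℂ (fun _ : Bond d (towerP L m (n + 1)) => c₀) W ((Dcl ∘L TGU) f) b'‖ ≤ BG * Real.exp (-(κ₀ * tdist m (piT b') w)) * F := by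
    intro w f F hfv hfF b'
    have hF : 0 ≤ F := (norm_nonneg _).trans (hfF b')
    rw [ContinuousLinearMap.comp_apply, hDcl, hTGU, LinearMap.coe_toContinuousLinearMap']
    refine ((GROW n η hηL c₀ c₁ hw hρ m hm U αU hα0 hα1 hU1 hreg εU hεU hUε hLb α hα hαG' hUst hUb hUη hpl hUgrad hRlev hεg hAQ hpos' hpos
      w f F hfv hfF μ b').1).trans ?_
    exact mul_le_mul_of_nonneg_right (mul_le_mul_of_nonneg_left (hweak _ hκ₀G (tdist_nonneg m _ _)) hBG) hF
  -- (L)(Q_k(U)†; KSU, κ₀) on coarse-bond sources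
  have hzone : ∀ (w : TSite d m) (h : BondL2K ℂ d m c₁ W) (H : ℝ), (∀ c', piC c' ≠ w → WL2.equiv ℂ (fun _ : Bond d m => c₁) W h c' = 0) →
      (∀ c', ‖WL2.equiv ℂ (fun _ : Bond d m => c₁) W h c'‖ ≤ H) → ∀ (b' : Bond d (towerP L m (n + 1))) (c' : Bond d m),
      (blockCoord (L ^ (n + 1)) m (siteCast (towerP_eq_fineP_pow L m (n + 1)) b'.1) = c'.1 ∨
        blockCoord (L ^ (n + 1)) m (siteCast (towerP_eq_fineP_pow L m (n + 1)) b'.1) = shift c'.2 c'.1) →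
      ‖WL2.equiv ℂ (fun _ : Bond d m => c₁) W h c'‖ ≤ Real.exp κ₀ * Real.exp (-(κ₀ * tdist m (piB b') w)) * H := by
    intro w h H hhv hhF b' c' hc
    have hH : 0 ≤ H := (norm_nonneg _).trans (hhF c')
    by_cases hcw : c'.1 = w
    · have hD : tdist m (piB b') w ≤ 1 := by
        show tdist m (blockCoord (L ^ (n + 1)) m (siteCast (towerP_eq_fineP_pow L m (n + 1)) b'.1)) w ≤ 1
        rcases hc with hc | hc
        · rw [hc, hcw, tdist_self]; exact zero_le_one
        · rw [hc, ← hcw, tdist_symm hm]; exact tdist_shift_le_one hm c'.1 c'.2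
      calc ‖WL2.equiv ℂ (fun _ : Bond d m => c₁) W h c'‖ ≤ 1 * H := by rw [one_mul]; exact hhF c'
        _ ≤ (Real.exp κ₀ * Real.exp (-(κ₀ * tdist m (piB b') w))) * H := mul_le_mul_of_nonneg_right (hcomp hD) hH
        _ = _ := by ring
    · rw [hhv c' hcw, norm_zero]; positivity
  have hLSU : ∀ (w : TSite d m) (h : BondL2K ℂ d m c₁ W) (H : ℝ), (∀ c', piC c' ≠ w → WL2.equiv ℂ (fun _ : Bond d m => c₁) W h c' = 0) →
      (∀ c', ‖WL2.equiv ℂ (fun _ : Bond d m => c₁) W h c'‖ ≤ H) →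
      ∀ b', ‖WL2.equiv ℂ (fun _ : Bond d (towerP L m (n + 1)) => c₀) W (SU h) b'‖ ≤ KSU * Real.exp (-(κ₀ * tdist m (piB b') w)) * H := by
    intro w h H hhv hhF b'
    have hH : 0 ≤ H := (norm_nonneg _).trans (hhF (w, ⟨0, hd⟩))
    rw [hSU, LinearMap.coe_toContinuousLinearMap']
    have hM : 0 ≤ Real.exp κ₀ * Real.exp (-(κ₀ * tdist m (piB b') w)) * H := by positivity
    have h1 := norm_adjoint_QkW_apply_le_local_sharp (c₀ := c₀) (c₁ := c₁) L m n φ U hL αU hα0 hα1 hU1 hreg hMφ hφ hMφ' hφ' hAQ h b' hM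
      (hzone w h H hhv hhF b')
    have he : c₁ / c₀ * (Mφ' * ((((L : ℝ) ^ (n + 1)) ^ d)⁻¹ * Real.exp (100 * d * (d + 1) * (L : ℝ) ^ d * AQ)) * Mφ) = Mφ' * Mφ * EA := by
      rw [hEA, ← hw]; field_simp
    rw [he] at h1
    exact h1.trans (le_of_eq (by rw [hKSU]; ring))
  -- (L)(K̃_k⁻¹; BP, κ₀) and (L)(K̃_k⁻¹ − K_k⁻¹; j₀·KX, κ₀) on the coarse bonds
  have hLKp : ∀ (w : TSite d m) (h : BondL2K ℂ d m c₁ W) (H : ℝ), (∀ c', piC c' ≠ w → WL2.equiv ℂ (fun _ : Bond d m => c₁) W h c' = 0) →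
      (∀ c', ‖WL2.equiv ℂ (fun _ : Bond d m => c₁) W h c'‖ ≤ H) →
      ∀ c', ‖WL2.equiv ℂ (fun _ : Bond d m => c₁) W (Kpcl h) c'‖ ≤ BP * Real.exp (-(κ₀ * tdist m (piC c') w)) * H := by
    intro w h H hhv hhF c'
    have hH : 0 ≤ H := (norm_nonneg _).trans (hhF c')
    rw [hKpcl, LinearMap.coe_toContinuousLinearMap']
    refine (HP n η hηL c₀ c₁ hw hρ m hm U αU hα0 hα1 hαL hU1 hreg εU hεU hUε hLb α hα hαP' hUst hUb hUη hpl hUgrad hRlev hεg hAQ hpos' hpos hc₀η j₀ hJ hjP' hposπ hQ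
      w h H hhv hhF c').trans ?_
    exact mul_le_mul_of_nonneg_right (mul_le_mul_of_nonneg_left (hweak _ hκ₀P (tdist_nonneg m _ _)) hBP) hH
  have hLKD : ∀ (w : TSite d m) (h : BondL2K ℂ d m c₁ W) (H : ℝ), (∀ c', piC c' ≠ w → WL2.equiv ℂ (fun _ : Bond d m => c₁) W h c' = 0) →
      (∀ c', ‖WL2.equiv ℂ (fun _ : Bond d m => c₁) W h c'‖ ≤ H) →
      ∀ c', ‖WL2.equiv ℂ (fun _ : Bond d m => c₁) W (KDcl h) c'‖ ≤ (j₀ * KX) * Real.exp (-(κ₀ * tdist m (piC c') w)) * H := by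
    intro w h H hhv hhF c'
    have hH : 0 ≤ H := (norm_nonneg _).trans (hhF c')
    rw [hKDcl, LinearMap.coe_toContinuousLinearMap', LinearMap.sub_apply]
    refine (HX n η hηL c₀ c₁ hw hρ m hm U αU hα0 hα1 hαL hU1 hreg εU hεU hUε hLb α hα hαX' hUst hUb hUη hpl hUgrad hRlev hεg hAQ hpos' hpos hc₀η j₀ hJ hjX' hposπ hQ
      w h H hhv hhF c').trans ?_
    exact mul_le_mul_of_nonneg_right (mul_le_mul_of_nonneg_left (hweak _ hκ₀X (tdist_nonneg m _ _)) (mul_nonneg hj₀ hKX)) hH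
  -- (2) the two words, the gradient falling on the left factors
  have hrow : ∀ w : TSite d m, ∑ u, Real.exp (-((κ₀ - κ₀ / 2) * tdist m w u)) ≤ S := fun w => by
    rw [show κ₀ - κ₀ / 2 = κ₀ / 2 by ring]; exact torusSum_le d hm (half_pos hκ₀0) w
  have hδ0 : ∀ u v : TSite d m, 0 ≤ tdist m u v := fun u v => tdist_nonneg _ _ _
  have hδt : ∀ u y v : TSite d m, tdist m u v ≤ tdist m u y + tdist m y v := fun u y v => tdist_triangle hm u y v
  have hκ'0 : (0 : ℝ) ≤ κ₀ / 2 := by positivity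
  have hκ'1 : κ₀ / 2 ≤ κ₀ := by linarith
  have hW1a := letter_comp (𝕜 := ℂ) (tdist m) piC piC piB Kpcl SU hδ0 hδt hBP hKSU0 hκ'0 hκ'1 hLKp hLSU hrow
  have hW1 := letter_comp (𝕜 := ℂ) (tdist m) piC piB piT (SU ∘L Kpcl) (Dcl ∘L TGd) hδ0 hδt (by positivity) (mul_nonneg hα'0 hBR) hκ'0 le_rfl hW1a hLDGd hrow
  have hW2a := letter_comp (𝕜 := ℂ) (tdist m) piC piC piB KDcl SU hδ0 hδt (mul_nonneg hj₀ hKX) hKSU0 hκ'0 hκ'1 hLKD hLSU hrow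
  have hW2 := letter_comp (𝕜 := ℂ) (tdist m) piC piB piT (SU ∘L KDcl) (Dcl ∘L TGU) hδ0 hδt (by positivity) hBG hκ'0 le_rfl hW2a hLDGU hrow
  -- (3) the telescoping identity, post-composed by the slice derivative
  have eP : H1LatticeK hposπ hQ z = Gt (LinearMap.adjoint QU (Kp z)) := rfl
  have eU : H1LatticeK hpos hQ z = GU (LinearMap.adjoint QU (KU z)) := rfl
  have hsplit : Dcl (Gt (LinearMap.adjoint QU (Kp z)) - GU (LinearMap.adjoint QU (KU z))) =
      (((Dcl ∘L TGd) ∘L (SU ∘L Kpcl)) + ((Dcl ∘L TGU) ∘L (SU ∘L KDcl))) z := by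
    have e : Gt (LinearMap.adjoint QU (Kp z)) - GU (LinearMap.adjoint QU (KU z)) = ((TGd ∘L (SU ∘L Kpcl)) + (TGU ∘L (SU ∘L KDcl))) z := by
      simp only [add_apply, ContinuousLinearMap.coe_comp, Function.comp_apply]
      rw [hTGd, hTGU, hSU, hKpcl, hKDcl]
      simp only [LinearMap.coe_toContinuousLinearMap']
      simp only [LinearMap.sub_apply, map_sub]
      abel
    rw [e]
    simp only [add_apply, ContinuousLinearMap.coe_comp, Function.comp_apply, map_add]
  set E : ℝ := Real.exp (-(κ₀ / 2 * tdist m (piT bd) v)) with hE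
  -- (i) the slice derivative at `U`
  have hi : ‖WL2.equiv ℂ (fun _ : Bond d (towerP L m (n + 1)) => c₀) W
        (covDerivL2K ℂ c₀ ((η : ℂ))⁻¹ (adTransportW φ U)
          ((WL2.equiv ℂ (fun _ : TSite d (towerP L m (n + 1)) => c₀) W).symm fun y =>
            WL2.equiv ℂ (fun _ : Bond d (towerP L m (n + 1)) => c₀) W (H1LatticeK hposπ hQ z - H1LatticeK hpos hQ z) (y, μ))) bd‖ ≤
      (BP * KSU * S * (α' * BR) * S + j₀ * KX * KSU * S * BG * S) * E * F := by
    rw [← hDcl (H1LatticeK hposπ hQ z - H1LatticeK hpos hQ z) bd, eP, eU, hsplit]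
    exact letter_add (𝕜 := ℂ) (tdist m) piC piT _ _ hW1 hW2 v z F hzv hzF bd
  have hKi : (BP * KSU * S * (α' * BR) * S + j₀ * KX * KSU * S * BG * S) * E * F ≤ (j₀ + α) * (BP * KSU * S * BR * S + KX * KSU * S * BG * S) * E * F := by
    have hE0 : 0 ≤ E := Real.exp_nonneg _
    have h1 : BP * KSU * S * (α' * BR) * S ≤ (j₀ + α) * (BP * KSU * S * BR * S) := by
      have : 0 ≤ BP * KSU * S * BR * S := by positivity
      nlinarith
    have h2 : j₀ * KX * KSU * S * BG * S ≤ (j₀ + α) * (KX * KSU * S * BG * S) := by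
      have : 0 ≤ KX * KSU * S * BG * S := by positivity
      nlinarith
    have h3 : (BP * KSU * S * (α' * BR) * S + j₀ * KX * KSU * S * BG * S) ≤ (j₀ + α) * (BP * KSU * S * BR * S + KX * KSU * S * BG * S) := by nlinarith
    exact mul_le_mul_of_nonneg_right (mul_le_mul_of_nonneg_right h3 hE0) hF
  have hi' := hi.trans hKi
  -- (ii) the covariant gradient at `U`
  have hii : ‖covGrad ((η : ℂ))⁻¹ (adTransportW φ U) (WL2.equiv ℂ (fun _ : Bond d (towerP L m (n + 1)) => c₀) W (H1LatticeK hposπ hQ z - H1LatticeK hpos hQ z)) (bd, μ)‖ ≤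
      (j₀ + α) * (BP * KSU * S * BR * S + KX * KSU * S * BG * S) * E * F := norm_covGrad_apply_le_of_slice _ _ _ bd μ hi'
  -- (iii) the flat gradient: `∇_1 = ∇_U + η⁻¹(1 − R(U(b)))(·)(b₊)` against the value letter at `b₊`
  set A : Bond d (towerP L m (n + 1)) → W := WL2.equiv ℂ (fun _ : Bond d (towerP L m (n + 1)) => c₀) W (H1LatticeK hposπ hQ z - H1LatticeK hpos hQ z) with hA
  have hval : ‖A (btgt bd, μ)‖ ≤ j₀ * KH * E * F := by
    have h := HH n η hηL c₀ c₁ hw hρ m hm U αU hα0 hα1 hαL hU1 hreg εU hεU hUε hLb α hα hαH' hUst hUb hUη hpl hUgrad hRlev hεg hAQ hpos' hpos hc₀η j₀ hJ hjH' hposπ hQ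
      v z F hzv hzF (btgt bd, μ)
    refine h.trans (mul_le_mul_of_nonneg_right (mul_le_mul_of_nonneg_left (Real.exp_le_exp.2 ?_) (mul_nonneg hj₀ hKH)) hF)
    have ht := hδ0 (piT bd) v
    show -(κH * tdist m (piT bd) v) ≤ -(κ₀ / 2 * tdist m (piT bd) v)
    nlinarith [mul_le_mul_of_nonneg_right (show κ₀ / 2 ≤ κH by linarith) ht]
  have hUb1 : ∀ b' : Bond d (towerP L m (n + 1)), (fun _ : Bond d (towerP L m (n + 1)) => (1 : 𝔸ˣ)) b' ∈ U1 𝔸 := fun _ => one_mem _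
  have hRε : ∀ w : W, ‖adTransportW φ U bd w - w‖ ≤ 2 * Mφ * Mφ' * (α * η) * ‖w‖ := fun w => by
    have h := norm_adTransportW_sub_adTransportW_le φ hφ hφ' hMφ' U (fun _ : Bond d (towerP L m (n + 1)) => (1 : 𝔸ˣ)) bd bd (hUb bd) (hUb1 bd) w
    rw [B5Eq172HodgePositivity.adTransportW_one, LinearMap.id_apply, Units.val_one] at h
    exact h.trans (by gcongr; exact hUη bd)
  have e3 : covGrad ((η : ℂ))⁻¹ (adTransportW φ (fun _ : Bond d (towerP L m (n + 1)) => (1 : 𝔸ˣ))) A (bd, μ) =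
      covGrad ((η : ℂ))⁻¹ (adTransportW φ U) A (bd, μ) + ((η : ℂ))⁻¹ • (A (btgt bd, μ) - adTransportW φ U bd (A (btgt bd, μ))) := by
    rw [covGrad_apply, covGrad_apply, B5Eq172HodgePositivity.adTransportW_one, LinearMap.id_apply, ← smul_add]
    congr 1
    abel
  have hcorr : ‖((η : ℂ))⁻¹ • (A (btgt bd, μ) - adTransportW φ U bd (A (btgt bd, μ)))‖ ≤ 2 * Mφ * Mφ' * (j₀ * KH) * E * F := by
    rw [norm_smul, hcn, norm_sub_rev]
    calc η⁻¹ * ‖adTransportW φ U bd (A (btgt bd, μ)) - A (btgt bd, μ)‖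
        ≤ η⁻¹ * (2 * Mφ * Mφ' * (α * η) * (j₀ * KH * E * F)) := by
          refine mul_le_mul_of_nonneg_left ((hRε _).trans ?_) (inv_nonneg.2 hη.le)
          exact mul_le_mul_of_nonneg_left hval (by positivity)
      _ = 2 * Mφ * Mφ' * (j₀ * KH) * α * E * F * (η⁻¹ * η) := by ring
      _ ≤ 2 * Mφ * Mφ' * (j₀ * KH) * 1 * E * F * 1 := by
          rw [inv_mul_cancel₀ hη.ne']
          have hE0 : 0 ≤ E := Real.exp_nonneg _
          gcongr
      _ = 2 * Mφ * Mφ' * (j₀ * KH) * E * F := by ring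
  have hiii : ‖covGrad ((η : ℂ))⁻¹ (adTransportW φ (fun _ : Bond d (towerP L m (n + 1)) => (1 : 𝔸ˣ))) A (bd, μ)‖ ≤ (j₀ + α) * K * E * F := by
    rw [e3]
    refine (norm_add_le _ _).trans ((add_le_add hii hcorr).trans ?_)
    have hE0 : 0 ≤ E := Real.exp_nonneg _
    have hx : 0 ≤ α * (2 * Mφ * Mφ' * KH) * (E * F) := by positivity
    have hring : (j₀ + α) * K * E * F = (j₀ + α) * (BP * KSU * S * BR * S + KX * KSU * S * BG * S) * E * F +
        2 * Mφ * Mφ' * (j₀ * KH) * E * F + α * (2 * Mφ * Mφ' * KH) * (E * F) := by rw [hK]; ring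
    rw [hring]
    linarith
  have hKle : (j₀ + α) * (BP * KSU * S * BR * S + KX * KSU * S * BG * S) * E * F ≤ (j₀ + α) * K * E * F := by
    have hE0 : 0 ≤ E := Real.exp_nonneg _
    have : 0 ≤ (j₀ + α) * (2 * Mφ * Mφ' * KH) * (E * F) := by positivity
    have hring : (j₀ + α) * K * E * F = (j₀ + α) * (BP * KSU * S * BR * S + KX * KSU * S * BG * S) * E * F + (j₀ + α) * (2 * Mφ * Mφ' * KH) * (E * F) := by
      rw [hK]; ring
    rw [hring]
    linarith
  exact ⟨hi'.trans hKle, hii.trans hKle, hiii⟩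

end Literature.MathematicalPhysics.QuantumFieldTheory.Balaban1983to89.B9Eq3133H1kPiSubH1kGradientLetterTower

end
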